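import Literature.IUT.HodgeArakelov.ModelCyclotomesZHat
import HarnessLib

/-!
# Bridge B8, parts 6 / Tate (companion): the last two `hZ`-carrying Tate-curve theorems, `hZ`-free
# (proof-only; consumer side of GAP-LEDGER row G-w4d021-1, closed-by p415192 modulo row G-w4d021-2 = `hYcl`)

Layer L6 of the abc-iut cell, seat abc-iut-w4-d008 (gen 2); PROOF-ONLY (0 definitions, no new named fact).
After `ModelCyclotomesZHat.lean` (abc-iut-L2-d1: the binder
`hZ : Nonempty (ModelCyclotomes.lDeltaQuot (C.rigidData μ hC hS h15 L) ≃* ZHat)` is the THEOREM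
`ModelCyclotomes.nonempty_lDeltaQuot_rigidData_mulEquiv_zHat … hO hYcl hl`) exactly two theorems of the tree
still took `hZ` as a hypothesis at the Tate curve `X̲̲_K` of an [EtTh] §1 theta setting (RQ7 audit
AUDIT-p414944-p415192, finding I1):

* `ThetaSetting.nonempty_def11Output_ofDoubleUnderline` (`ModelDef11Output.lean`, abc-iut-L6-d6) — existence
  of the [IUTchII] Def. 1.1 (i)+(ii) output for every mono-theta environment of the §1 setting
  [claim: Mochizuki2012, status: disputed] (IUTchII §1 Def 1.1, kurims pp.20-21);
* `ThetaSetting.prop12_i_indeterminacy_envOfGroup_ofDoubleUnderline` (`MonoThetaFromGroupsProofsTate.lean`,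
  abc-iut-w4-d008) — the [IUTchII] Prop. 1.2 (i) isomorphism-indeterminacy clause for bridge B8 part 6's
  CHOSEN `M^Θ(Π)` [claim: Mochizuki2012, status: disputed] (IUTchII §1 Prop 1.2 (i), kurims p.25), whose
  very STATEMENT mentions `hZ` (it is an argument of the construction `envOfGroup`).

This file lands their `_of_origin` forms: `hZ` is instantiated by the theorem, so the remaining inputs are
exactly those of the rest of the Tate-curve chain — L2-t1's named fact `Prop15iii` ([EtTh] Prop. 1.5 (iii)),
the freeness guard `IsEtThOrigin` ([EtTh] §1, PRIMS p. 12: "Since `Δ_X` is a profinite free group on 2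
generators" [cite: MochizukiEtTh2009, §1 p.12]), the closedness binder `hYcl` (GAP-LEDGER row G-w4d021-2;
[EtTh] §1 p. 13: "we have a natural exact sequence of abelian profinite groups
`1 → Δ_Θ → (Δ^tp_Y)^Θ → (Δ^tp_Y)^ell → 1`" [cite: MochizukiEtTh2009, §1 p.13]), the printed side conditions
of [IUTchII] §1 p. 20 (`l` prime, `p ≠ 2`, `p ≠ l`, `ζ_{4l} ∈ K`) and a theta cocycle `η`.

* `ThetaSetting.nonempty_def11Output_ofDoubleUnderline_of_origin`;
* `ThetaSetting.nonempty_envOfGroup_ofDoubleUnderline_of_origin` (the Prop. 1.2 (i) output `M^Θ(Π)` of bridge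
  B8 part 6 exists at the Tate curve, `hZ`-free);
* `ThetaSetting.prop12_i_indeterminacy_envOfGroup_ofDoubleUnderline_of_origin`.

HONEST FRAMING: bookkeeping over a refereed source's typed interface ([EtTh]) and kernel-checked implications
between typed [IUTchII] statements (claim key Mochizuki2012, DISPUTED, D-0012); nothing disputed is asserted;
the theta setting is data quoting print, not asserted to exist; no side taken on [IUTchIII] Cor. 3.12;
typed ≠ discharged for the remaining binders. Nothing of another seat is edited or restated.
-/

noncomputable section

namespace Literature.IUT.HodgeArakelov

open Literature.AnabelianGeometry.EtaleTheta Literature.AnabelianGeometry.SemiGraphs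

namespace ThetaSetting

section Tate

variable {p : ℕ} [Fact p.Prime] {D : Literature.AnabelianGeometry.EtaleTheta.ThetaSetting p}
  {E : D.EtaleThetaData} {l : ℕ} (C : E.DoubleUnderline l) {N : ℕ+} (μ : D.CyclotomeMod l N)
  (hC : D.Compat) (hS : D.Sec2Hyps)

/-- **Existence of the [IUTchII] Def. 1.1 output for the Tate curve `X̲̲_K`, `hZ`-free**: every mono-theta
environment of the [IUTchII] §1 setting `ofDoubleUnderline` carries a Def. 1.1 (i)+(ii) output over L2-t8's real
rigidity data `C.rigidData μ hC hS h15 L` — abc-iut-L6-d6's `nonempty_def11Output_ofDoubleUnderline` with its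
binder `hZ` ("`(l·Δ_Θ)/thetaKer ≅ Ẑ`") supplied by `ModelCyclotomes.nonempty_lDeltaQuot_rigidData_mulEquiv_zHat`;
inputs now `Prop15iii`, `IsEtThOrigin`, `hYcl`, the printed side conditions and a theta cocycle.
[claim: Mochizuki2012, status: disputed] (IUTchII §1 Def 1.1, kurims pp.20-21) -/
theorem nonempty_def11Output_ofDoubleUnderline_of_origin
    (h15 : Literature.AnabelianGeometry.EtaleTheta.ThetaSetting.Prop15iii E hC) (L : C.CuspLabels)
    (hl : l.Prime) (hp2 : p ≠ 2) (hpl : p ≠ l) (hζ : ∃ ζ : D.K, IsPrimitiveRoot ζ (4 * l))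
    {η : (C.thetaEnvData μ hC hS).PiYdd → MuN p N} (hη : η ∈ (C.thetaEnvData μ hC hS).thetaCocycles)
    (hO : D.IsEtThOrigin)
    (hYcl : (D.DtpY.map D.toHat.toMonoidHom).topologicalClosure ≤
      D.DtpY.map D.toHat.toMonoidHom ⊔ (⁅⁅D.DeltaHat, D.DeltaHat⁆, D.DeltaHat⁆).topologicalClosure)
    (M : MonoThetaEnv (ofDoubleUnderline C μ hC hS hl hp2 hpl hζ hη)) : Nonempty (Def11Output M) :=
  nonempty_def11Output_ofDoubleUnderline C μ hC hS h15 L hl hp2 hpl hζ hη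
    (ModelCyclotomes.nonempty_lDeltaQuot_rigidData_mulEquiv_zHat C μ hC hS h15 L hO hYcl hl.ne_zero) M

/-- **Existence of the [IUTchII] Prop. 1.2 (i) output `Π ↦ M^Θ(Π)` at the Tate curve, `hZ`-free**: for every
topological group `Π ≅ Π^tp_{X̲̲_K}`, bridge B8 part 6's `envOfGroup` over the [IUTchII] §1 setting
`ofDoubleUnderline`, with the cyclotome identification `(l·Δ_Θ)(M) ≅ Ẑ` no longer a hypothesis but the theorem
`ModelCyclotomes.nonempty_lDeltaQuot_rigidData_mulEquiv_zHat`. [claim: Mochizuki2012, status: disputed] (IUTchII §1 Prop 1.2 (i), kurims p.25) -/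
theorem nonempty_envOfGroup_ofDoubleUnderline_of_origin
    (h15 : Literature.AnabelianGeometry.EtaleTheta.ThetaSetting.Prop15iii E hC) (L : C.CuspLabels)
    (hl : l.Prime) (hp2 : p ≠ 2) (hpl : p ≠ l) (hζ : ∃ ζ : D.K, IsPrimitiveRoot ζ (4 * l))
    {η : (C.thetaEnvData μ hC hS).PiYdd → MuN p N} (hη : η ∈ (C.thetaEnvData μ hC hS).thetaCocycles)
    (hO : D.IsEtThOrigin)
    (hYcl : (D.DtpY.map D.toHat.toMonoidHom).topologicalClosure ≤
      D.DtpY.map D.toHat.toMonoidHom ⊔ (⁅⁅D.DeltaHat, D.DeltaHat⁆, D.DeltaHat⁆).topologicalClosure)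
    (P : TopGroup.{0}) (hP : Nonempty (P ≃ₜ* (ofDoubleUnderline C μ hC hS hl hp2 hpl hζ hη).PiX)) :
    Nonempty (EnvOfGroup (ofDoubleUnderline C μ hC hS hl hp2 hpl hζ hη) P) :=
  nonempty_envOfGroup (C.rigidData μ hC hS h15 L) (SideData.ofDoubleUnderline C μ hC hS hl hp2 hpl hζ hη)
    (t1Space_Huu C) (isClosed_ker_aug_thetaEnvData C μ hC hS)
    (ModelCyclotomes.nonempty_lDeltaQuot_rigidData_mulEquiv_zHat C μ hC hS h15 L hO hYcl hl.ne_zero) P hP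

/-- **[IUTchII] Prop. 1.2 (i) for the Tate curve `X̲̲_K`, indeterminacy clause of the CHOSEN `M^Θ(Π)`,
`hZ`-free**: for every topological group `Π ≅ Π^tp_{X̲̲_K}`, bridge B8 part 6's `envOfGroup` — built with the
cyclotome identification supplied by `ModelCyclotomes.nonempty_lDeltaQuot_rigidData_mulEquiv_zHat` — has the
printed isomorphism indeterminacy (`1` resp. `2` `μ_N`-conjugacy classes of automorphisms over `Π_Y` for `N` odd
resp. even), [EtTh] Cor. 2.18 (iv) being supplied by L2's proved chain (`rigidData_cor218_iv_fibre_of_origin`).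
This is abc-iut-w4-d008's `prop12_i_indeterminacy_envOfGroup_ofDoubleUnderline` with `hZ` instantiated inside
its statement. [claim: Mochizuki2012, status: disputed] (IUTchII §1 Prop 1.2 (i), kurims p.25) -/
theorem prop12_i_indeterminacy_envOfGroup_ofDoubleUnderline_of_origin
    (h15 : Literature.AnabelianGeometry.EtaleTheta.ThetaSetting.Prop15iii E hC) (L : C.CuspLabels)
    (hl : l.Prime) (hp2 : p ≠ 2) (hpl : p ≠ l) (hζ : ∃ ζ : D.K, IsPrimitiveRoot ζ (4 * l))
    {η : (C.thetaEnvData μ hC hS).PiYdd → MuN p N} (hη : η ∈ (C.thetaEnvData μ hC hS).thetaCocycles)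
    (hO : D.IsEtThOrigin)
    (hYcl : (D.DtpY.map D.toHat.toMonoidHom).topologicalClosure ≤
      D.DtpY.map D.toHat.toMonoidHom ⊔ (⁅⁅D.DeltaHat, D.DeltaHat⁆, D.DeltaHat⁆).topologicalClosure)
    (P : TopGroup.{0}) (hP : Nonempty (P ≃ₜ* (ofDoubleUnderline C μ hC hS hl hp2 hpl hζ hη).PiX)) :
    Prop12_i_indeterminacy
      (envOfGroup (C.rigidData μ hC hS h15 L) (SideData.ofDoubleUnderline C μ hC hS hl hp2 hpl hζ hη)
        (t1Space_Huu C) (isClosed_ker_aug_thetaEnvData C μ hC hS)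
        (ModelCyclotomes.nonempty_lDeltaQuot_rigidData_mulEquiv_zHat C μ hC hS h15 L hO hYcl hl.ne_zero)
        P hP).recon :=
  prop12_i_indeterminacy_envOfGroup_ofDoubleUnderline C μ hC hS h15 L hl hp2 hpl hζ hη
    (ModelCyclotomes.nonempty_lDeltaQuot_rigidData_mulEquiv_zHat C μ hC hS h15 L hO hYcl hl.ne_zero)
    hO hYcl P hP

end Tate

end ThetaSetting

end Literature.IUT.HodgeArakelov

end
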